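import Summits.HodgeConjecture.CorCM.IrreducibleOddWeightsIsotypicCells
import Mathlib.Algebra.Module.LinearMap.End
import Mathlib.LinearAlgebra.Dimension.Free
import HarnessLib

/-!
# Density over the commutant, I: THE SCHUR PACKAGE — the commutant of a stable irreducible `A` is a DIVISION ALGEBRA
# on `A`; its orbits `D·a` (the D-LINES) are irreducible for the commutant, pairwise EQUAL OR DISJOINT, of one common
# dimension `δ`, and `δ ∣ dim A`

COR-CM (cell `pub-hodgecm2`, binder seat `b16` gen 72, count-neutral claim DENSITY OVER THE COMMUTANT, file C1 —
pure linear algebra; theorems only, no definition, no named fact, no `sorry`).  NEW as organised here, hence under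
`Summits/`.  HONEST FRAMING: Schur's lemma and its first consequences in the lane's unbundled shape (ONE ℚ-space `V`,
a FAMILY of operators `T_i` — e.g. the translates `f ↦ f(k·)` of a group action —, a stable IRREDUCIBLE
finite-dimensional `A ≤ V`, NO scalar-commutant hypothesis); the groundwork that removes the hypothesis «scalar
commutant» from gen 70's density and multiplicity files I8/I9 (`IrreducibleOddWeightsIsotypicDensity`,
`…Multiplicity`): there `δ = 1`.  `HC_CM` is neither used nor asserted; nothing here mentions CM fields.

THE COMMUTANT IS A PARAMETER, NOT A DEFINITION.  Every statement takes a subspace `𝒟 ≤ End_ℚ(V)` together with the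
hypothesis `h𝒟 : L ∈ 𝒟 ↔ (L(A) ⊆ A ∧ L T_i = T_i L on A)` characterising it; §1 shows such a `𝒟` exists, so the
hypothesis is never vacuous.  The D-LINE of `a` is `D·a = 𝒟.map (applyₗ a) = {L a : L ∈ 𝒟}`; for `0 ≠ a ∈ A` its
dimension `δ` is the degree `[D : ℚ]` of the division algebra `D = 𝒟|_A`.

* §1 The commutant exists (`exists_commutant`); it contains `id` and is closed under composition.
* §2 The span of the operators: it preserves `A`, COMMUTES with the commutant on `A`, and acts TRANSITIVELY on a
  non-zero irreducible `A` (`exists_mem_span_range_apply_eq`: `span(T)·a = A` for `0 ≠ a ∈ A`).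
* §3 **SCHUR** (`commutant_zero_or_injOn`): every `L ∈ 𝒟` is `0` on `A` or injective on `A`; then `L(A) = A`
  (`commutant_map_eq_of_ne`) and `L` has a TWO-SIDED INVERSE IN `𝒟` on `A` (`exists_commutant_inverse`).
* §4 **D-LINES**: `D·a ≤ A` is `𝒟`-stable and `𝒟`-IRREDUCIBLE (`map_applyₗ_irreducible`); two D-lines are EQUAL OR
  MEET TRIVIALLY (`map_applyₗ_eq_or_inf_eq_bot`); `D·(φ a) = φ(D·a)` for `φ ∈ span(T)`, hence ALL D-lines of non-zero
  elements have THE SAME DIMENSION `δ` (`finrank_map_applyₗ_eq`), and **`δ ∣ dim A`**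
  (`finrank_map_applyₗ_dvd_finrank`, file I1's quantisation for the family `𝒟`).
Files C2–C4 continue with density for D-free tuples, `dim 𝔐(b)·δ = dim D⟨b⟩·dim A` and its shadow ∕ CM dress.

## References

* [Lang2002] S. Lang, *Algebra*, 3rd ed., XVII §1 Prop. 1.1 (Schur's lemma), XVII §3 (density).
* [Serre1977] J.-P. Serre, *Linear Representations of Finite Groups*, GTM 42, §2.2 (Schur's lemma).
* [CurtisReiner1962] C. W. Curtis, I. Reiner, *Representation Theory of Finite Groups and Associative Algebras*,
  §27, (27.3) (Schur's lemma: the commutant of an irreducible module is a division ring).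
-/

set_option autoImplicit false

noncomputable section

open scoped BigOperators Classical

universe v w

namespace Summit.HodgeConjecture.CorCM.IrrOdd

variable {V : Type v} [AddCommGroup V] [Module ℚ V] {ι : Type w} (T : ι → V →ₗ[ℚ] V)

/-! ### §1 The commutant -/

/-- **THE COMMUTANT EXISTS**: the linear maps `L : V → V` with `L(A) ⊆ A` commuting with every `T_i` on `A` form a
subspace `𝒟` of `End_ℚ(V)` — the shape in which every later statement takes the commutant as a parameter.
[cite: CurtisReiner1962, §27 (27.3)] -/
theorem exists_commutant (A : Submodule ℚ V) :
    ∃ 𝒟 : Submodule ℚ (V →ₗ[ℚ] V), ∀ L : V →ₗ[ℚ] V,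
      L ∈ 𝒟 ↔ (∀ a ∈ A, L a ∈ A) ∧ ∀ (i : ι) (a : V), a ∈ A → L (T i a) = T i (L a) := by
  refine ⟨{ carrier := {L : V →ₗ[ℚ] V | (∀ a ∈ A, L a ∈ A) ∧ ∀ (i : ι) (a : V), a ∈ A → L (T i a) = T i (L a)}
            add_mem' := ?_
            zero_mem' := ?_
            smul_mem' := ?_ }, fun L => Iff.rfl⟩
  · intro L L' hL hL'
    exact ⟨fun a ha => by rw [LinearMap.add_apply]; exact A.add_mem (hL.1 a ha) (hL'.1 a ha),
      fun i a ha => by rw [LinearMap.add_apply, LinearMap.add_apply, map_add, hL.2 i a ha, hL'.2 i a ha]⟩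
  · exact ⟨fun a _ => by rw [LinearMap.zero_apply]; exact A.zero_mem,
      fun i a _ => by rw [LinearMap.zero_apply, LinearMap.zero_apply, map_zero]⟩
  · intro t L hL
    exact ⟨fun a ha => by rw [LinearMap.smul_apply]; exact A.smul_mem t (hL.1 a ha),
      fun i a ha => by rw [LinearMap.smul_apply, LinearMap.smul_apply, map_smul, hL.2 i a ha]⟩

/-- The identity lies in the commutant. [cite: CurtisReiner1962, §27 (27.3)] -/
theorem commutant_id_mem {𝒟 : Submodule ℚ (V →ₗ[ℚ] V)} {A : Submodule ℚ V}
    (h𝒟 : ∀ L : V →ₗ[ℚ] V, L ∈ 𝒟 ↔ (∀ a ∈ A, L a ∈ A) ∧ ∀ (i : ι) (a : V), a ∈ A → L (T i a) = T i (L a)) :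
    (LinearMap.id : V →ₗ[ℚ] V) ∈ 𝒟 :=
  (h𝒟 _).2 ⟨fun _ ha => ha, fun _ _ _ => rfl⟩

/-- The commutant is closed under composition. [cite: CurtisReiner1962, §27 (27.3)] -/
theorem commutant_comp_mem {𝒟 : Submodule ℚ (V →ₗ[ℚ] V)} {A : Submodule ℚ V}
    (h𝒟 : ∀ L : V →ₗ[ℚ] V, L ∈ 𝒟 ↔ (∀ a ∈ A, L a ∈ A) ∧ ∀ (i : ι) (a : V), a ∈ A → L (T i a) = T i (L a))
    {L L' : V →ₗ[ℚ] V} (hL : L ∈ 𝒟) (hL' : L' ∈ 𝒟) : L ∘ₗ L' ∈ 𝒟 := by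
  obtain ⟨hLA, hLc⟩ := (h𝒟 L).1 hL
  obtain ⟨hL'A, hL'c⟩ := (h𝒟 L').1 hL'
  exact (h𝒟 _).2 ⟨fun a ha => hLA _ (hL'A a ha),
    fun i a ha => by rw [LinearMap.comp_apply, LinearMap.comp_apply, hL'c i a ha, hLc i _ (hL'A a ha)]⟩

/-! ### §2 The span of the operators: stability, commutation with the commutant, transitivity -/

/-- `A` is stable under the ℚ-span of the operators. [cite: Lang2002, XVII §3] -/
theorem apply_mem_of_mem_span_range {A : Submodule ℚ V} (hAst : ∀ (i : ι) (v : V), v ∈ A → T i v ∈ A)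
    {φ : V →ₗ[ℚ] V} (hφ : φ ∈ Submodule.span ℚ (Set.range T)) {a : V} (ha : a ∈ A) : φ a ∈ A := by
  induction hφ using Submodule.span_induction with
  | mem φ hφ =>
    obtain ⟨i, rfl⟩ := hφ
    exact hAst i a ha
  | zero => rw [LinearMap.zero_apply]; exact A.zero_mem
  | add φ ψ _ _ hφ hψ => rw [LinearMap.add_apply]; exact A.add_mem hφ hψ
  | smul t φ _ hφ => rw [LinearMap.smul_apply]; exact A.smul_mem t hφ

/-- The span of a family closed under composition is closed under left composition with the family. [folklore] -/
theorem comp_mem_span_range (hmul : ∀ i i' : ι, ∃ i'' : ι, T i'' = T i ∘ₗ T i') (i : ι)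
    {φ : V →ₗ[ℚ] V} (hφ : φ ∈ Submodule.span ℚ (Set.range T)) : T i ∘ₗ φ ∈ Submodule.span ℚ (Set.range T) := by
  induction hφ using Submodule.span_induction with
  | mem φ hφ =>
    obtain ⟨i', rfl⟩ := hφ
    obtain ⟨i'', hi''⟩ := hmul i i'
    exact Submodule.subset_span ⟨i'', hi''⟩
  | zero => rw [LinearMap.comp_zero]; exact Submodule.zero_mem _
  | add φ ψ _ _ hφ hψ => rw [LinearMap.comp_add]; exact Submodule.add_mem _ hφ hψ
  | smul t φ _ hφ => rw [LinearMap.comp_smul]; exact Submodule.smul_mem _ t hφ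

/-- **THE SPAN OF THE OPERATORS COMMUTES WITH THE COMMUTANT ON `A`**: `L (φ a) = φ (L a)` for `L ∈ 𝒟`,
`φ ∈ span(T)`, `a ∈ A`. [cite: Lang2002, XVII §3] -/
theorem commutant_apply_comm_of_mem_span_range {𝒟 : Submodule ℚ (V →ₗ[ℚ] V)} {A : Submodule ℚ V}
    (h𝒟 : ∀ L : V →ₗ[ℚ] V, L ∈ 𝒟 ↔ (∀ a ∈ A, L a ∈ A) ∧ ∀ (i : ι) (a : V), a ∈ A → L (T i a) = T i (L a))
    {L : V →ₗ[ℚ] V} (hL : L ∈ 𝒟) {φ : V →ₗ[ℚ] V} (hφ : φ ∈ Submodule.span ℚ (Set.range T)) {a : V}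
    (ha : a ∈ A) : L (φ a) = φ (L a) := by
  induction hφ using Submodule.span_induction with
  | mem φ hφ =>
    obtain ⟨i, rfl⟩ := hφ
    exact ((h𝒟 L).1 hL).2 i a ha
  | zero => rw [LinearMap.zero_apply, LinearMap.zero_apply, map_zero]
  | add φ ψ _ _ hφ hψ => rw [LinearMap.add_apply, LinearMap.add_apply, map_add, hφ, hψ]
  | smul t φ _ hφ => rw [LinearMap.smul_apply, LinearMap.smul_apply, map_smul, hφ]

/-- **TRANSITIVITY: `span(T)·a = A`** for `0 ≠ a ∈ A`, `A` stable irreducible, `T` closed under composition with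
identity (`span(T)·a` is a non-zero stable subspace of `A`). [cite: Lang2002, XVII §3] -/
theorem map_applyₗ_span_range_eq (h1 : ∃ i₀ : ι, T i₀ = LinearMap.id)
    (hmul : ∀ i i' : ι, ∃ i'' : ι, T i'' = T i ∘ₗ T i') {A : Submodule ℚ V}
    (hAst : ∀ (i : ι) (v : V), v ∈ A → T i v ∈ A)
    (hAirr : ∀ W : Submodule ℚ V, W ≤ A → W ≠ ⊥ → (∀ (i : ι) (v : V), v ∈ W → T i v ∈ W) → W = A)
    {a : V} (ha : a ∈ A) (ha0 : a ≠ 0) :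
    (Submodule.span ℚ (Set.range T)).map (LinearMap.applyₗ a) = A := by
  refine hAirr _ ?_ ?_ ?_
  · rintro _ ⟨φ, hφ, rfl⟩
    rw [LinearMap.applyₗ_apply_apply]
    exact apply_mem_of_mem_span_range T hAst hφ ha
  · obtain ⟨i₀, hi₀⟩ := h1
    intro h
    have hmem : a ∈ (Submodule.span ℚ (Set.range T)).map (LinearMap.applyₗ a) :=
      ⟨T i₀, Submodule.subset_span ⟨i₀, rfl⟩, by rw [LinearMap.applyₗ_apply_apply, hi₀, LinearMap.id_apply]⟩
    rw [h, Submodule.mem_bot] at hmem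
    exact ha0 hmem
  · rintro i _ ⟨φ, hφ, rfl⟩
    refine ⟨T i ∘ₗ φ, comp_mem_span_range T hmul i hφ, ?_⟩
    rw [LinearMap.applyₗ_apply_apply, LinearMap.applyₗ_apply_apply, LinearMap.comp_apply]

/-- Transitivity, elementwise: `a′ = φ a` for some `φ ∈ span(T)` (`0 ≠ a ∈ A`, `a′ ∈ A`). [cite: Lang2002, XVII §3] -/
theorem exists_mem_span_range_apply_eq (h1 : ∃ i₀ : ι, T i₀ = LinearMap.id)
    (hmul : ∀ i i' : ι, ∃ i'' : ι, T i'' = T i ∘ₗ T i') {A : Submodule ℚ V}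
    (hAst : ∀ (i : ι) (v : V), v ∈ A → T i v ∈ A)
    (hAirr : ∀ W : Submodule ℚ V, W ≤ A → W ≠ ⊥ → (∀ (i : ι) (v : V), v ∈ W → T i v ∈ W) → W = A)
    {a a' : V} (ha : a ∈ A) (ha0 : a ≠ 0) (ha' : a' ∈ A) :
    ∃ φ ∈ Submodule.span ℚ (Set.range T), φ a = a' := by
  rw [← map_applyₗ_span_range_eq T h1 hmul hAst hAirr ha ha0] at ha'
  obtain ⟨φ, hφ, hφa⟩ := ha'
  exact ⟨φ, hφ, by rw [← LinearMap.applyₗ_apply_apply a φ]; exact hφa⟩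

/-! ### §3 Schur -/

/-- **SCHUR: every `L ∈ 𝒟` is ZERO on `A` or INJECTIVE on `A`** (`ker L ∩ A` is a stable subspace of the irreducible
`A`). [cite: Lang2002, XVII §1 Prop. 1.1] [cite: Serre1977, §2.2] [cite: CurtisReiner1962, §27 (27.3)] -/
theorem commutant_zero_or_injOn {𝒟 : Submodule ℚ (V →ₗ[ℚ] V)} {A : Submodule ℚ V}
    (h𝒟 : ∀ L : V →ₗ[ℚ] V, L ∈ 𝒟 ↔ (∀ a ∈ A, L a ∈ A) ∧ ∀ (i : ι) (a : V), a ∈ A → L (T i a) = T i (L a))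
    (hAst : ∀ (i : ι) (v : V), v ∈ A → T i v ∈ A)
    (hAirr : ∀ W : Submodule ℚ V, W ≤ A → W ≠ ⊥ → (∀ (i : ι) (v : V), v ∈ W → T i v ∈ W) → W = A)
    {L : V →ₗ[ℚ] V} (hL : L ∈ 𝒟) : (∀ a ∈ A, L a = 0) ∨ ∀ a ∈ A, L a = 0 → a = 0 := by
  obtain ⟨-, hLc⟩ := (h𝒟 L).1 hL
  by_cases hW : LinearMap.ker L ⊓ A = ⊥
  · refine Or.inr fun a ha h0 => ?_
    have hmem : a ∈ LinearMap.ker L ⊓ A := ⟨LinearMap.mem_ker.2 h0, ha⟩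
    rwa [hW, Submodule.mem_bot] at hmem
  · refine Or.inl fun a ha => ?_
    have hWA : LinearMap.ker L ⊓ A = A := hAirr _ inf_le_right hW fun i v hv =>
      ⟨LinearMap.mem_ker.2 (by rw [hLc i v hv.2, LinearMap.mem_ker.1 hv.1, map_zero]), hAst i v hv.2⟩
    have ha' : a ∈ LinearMap.ker L ⊓ A := by rw [hWA]; exact ha
    exact LinearMap.mem_ker.1 ha'.1

/-- Schur, image form: `L ∈ 𝒟` not zero on the finite-dimensional irreducible `A` ⟹ **`L(A) = A`**.
[cite: Lang2002, XVII §1 Prop. 1.1] [cite: CurtisReiner1962, §27 (27.3)] -/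
theorem commutant_map_eq_of_ne {𝒟 : Submodule ℚ (V →ₗ[ℚ] V)} {A : Submodule ℚ V} [FiniteDimensional ℚ A]
    (h𝒟 : ∀ L : V →ₗ[ℚ] V, L ∈ 𝒟 ↔ (∀ a ∈ A, L a ∈ A) ∧ ∀ (i : ι) (a : V), a ∈ A → L (T i a) = T i (L a))
    (hAst : ∀ (i : ι) (v : V), v ∈ A → T i v ∈ A)
    (hAirr : ∀ W : Submodule ℚ V, W ≤ A → W ≠ ⊥ → (∀ (i : ι) (v : V), v ∈ W → T i v ∈ W) → W = A)
    {L : V →ₗ[ℚ] V} (hL : L ∈ 𝒟) (hne : ¬ ∀ a ∈ A, L a = 0) : A.map L = A := by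
  obtain ⟨hLA, -⟩ := (h𝒟 L).1 hL
  have hinj := (commutant_zero_or_injOn T h𝒟 hAst hAirr hL).resolve_left hne
  have hle : A.map L ≤ A := by
    rintro _ ⟨a, ha, rfl⟩
    exact hLA a ha
  refine Submodule.eq_of_le_of_finrank_eq hle ?_
  rw [← LinearMap.range_domRestrict]
  have hk : LinearMap.ker (L.domRestrict A) = ⊥ := by
    rw [eq_bot_iff]
    intro a ha
    rw [Submodule.mem_bot]
    exact Subtype.ext (hinj a a.2 ha)
  have h := LinearMap.finrank_range_add_finrank_ker (L.domRestrict A)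
  rw [hk, finrank_bot, add_zero] at h
  exact h

/-- **SCHUR, INVERSE FORM: the commutant is a DIVISION ALGEBRA on `A`.**  `L ∈ 𝒟` not zero on the finite-dimensional
irreducible `A` ⟹ there is `L′ ∈ 𝒟` with values in `A`, `L′ (L a) = a` and `L (L′ a) = a` for `a ∈ A`.
[cite: Lang2002, XVII §1 Prop. 1.1] [cite: Serre1977, §2.2] [cite: CurtisReiner1962, §27 (27.3)] -/
theorem exists_commutant_inverse {𝒟 : Submodule ℚ (V →ₗ[ℚ] V)} {A : Submodule ℚ V} [FiniteDimensional ℚ A]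
    (h𝒟 : ∀ L : V →ₗ[ℚ] V, L ∈ 𝒟 ↔ (∀ a ∈ A, L a ∈ A) ∧ ∀ (i : ι) (a : V), a ∈ A → L (T i a) = T i (L a))
    (hAst : ∀ (i : ι) (v : V), v ∈ A → T i v ∈ A)
    (hAirr : ∀ W : Submodule ℚ V, W ≤ A → W ≠ ⊥ → (∀ (i : ι) (v : V), v ∈ W → T i v ∈ W) → W = A)
    {L : V →ₗ[ℚ] V} (hL : L ∈ 𝒟) (hne : ¬ ∀ a ∈ A, L a = 0) :
    ∃ L' ∈ 𝒟, (∀ v, L' v ∈ A) ∧ (∀ a ∈ A, L' (L a) = a) ∧ ∀ a ∈ A, L (L' a) = a := by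
  obtain ⟨hLA, hLc⟩ := (h𝒟 L).1 hL
  have hinj := (commutant_zero_or_injOn T h𝒟 hAst hAirr hL).resolve_left hne
  -- the restriction of `L` to `A` is a bijection
  let LA : A →ₗ[ℚ] A := L.restrict fun a ha => hLA a ha
  have hLAval : ∀ x : A, (LA x : V) = L x := fun x => rfl
  have hLAinj : Function.Injective LA := by
    intro x y hxy
    apply Subtype.ext
    have h : (LA x : V) = LA y := by rw [hxy]
    rw [hLAval, hLAval] at h
    have h0 : L (x - y : V) = 0 := by rw [map_sub, h, sub_self]
    exact sub_eq_zero.1 (hinj _ (A.sub_mem x.2 y.2) h0)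
  let e : A ≃ₗ[ℚ] A := LinearEquiv.ofBijective LA ⟨hLAinj, LinearMap.surjective_of_injective hLAinj⟩
  have he : ∀ x : A, (e x : V) = L x := fun x => rfl
  -- a linear retraction `π : V → A`
  obtain ⟨π, hπ⟩ := A.subtype.exists_leftInverse_of_injective A.ker_subtype
  have hπa : ∀ (a : V) (ha : a ∈ A), π a = ⟨a, ha⟩ := fun a ha => by
    have h := LinearMap.congr_fun hπ ⟨a, ha⟩
    rw [LinearMap.comp_apply, LinearMap.id_apply] at h
    exact h
  -- the inverse `L′ = e⁻¹ ∘ π`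
  have hval : ∀ v : V, (A.subtype ∘ₗ e.symm.toLinearMap ∘ₗ π) v = (e.symm (π v) : V) := fun v => rfl
  have hA' : ∀ v : V, (A.subtype ∘ₗ e.symm.toLinearMap ∘ₗ π) v ∈ A := fun v => by
    rw [hval]; exact (e.symm (π v)).2
  have hlinv : ∀ a ∈ A, (A.subtype ∘ₗ e.symm.toLinearMap ∘ₗ π) (L a) = a := fun a ha => by
    rw [hval, hπa (L a) (hLA a ha), show (⟨L a, hLA a ha⟩ : A) = e ⟨a, ha⟩ from Subtype.ext (he ⟨a, ha⟩).symm,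
      LinearEquiv.symm_apply_apply]
  have hrinv : ∀ a ∈ A, L ((A.subtype ∘ₗ e.symm.toLinearMap ∘ₗ π) a) = a := fun a ha => by
    rw [hval, hπa a ha, ← he, LinearEquiv.apply_symm_apply]
  refine ⟨A.subtype ∘ₗ e.symm.toLinearMap ∘ₗ π, (h𝒟 _).2 ⟨fun a _ => hA' a, fun i a ha => ?_⟩, hA', hlinv, hrinv⟩
  -- commutation: `L′ (T_i a) = L′ (T_i (L (L′ a))) = L′ (L (T_i (L′ a))) = T_i (L′ a)`
  conv_lhs => rw [← hrinv a ha]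
  rw [← hLc i _ (hA' a), hlinv _ (hAst i _ (hA' a))]

/-! ### §4 D-lines -/

/-- Membership in a D-line: `v ∈ D·a ⟺ v = L a` for some `L ∈ 𝒟`. [folklore] -/
theorem mem_map_applyₗ_iff (𝒟 : Submodule ℚ (V →ₗ[ℚ] V)) (a v : V) :
    v ∈ 𝒟.map (LinearMap.applyₗ a) ↔ ∃ L ∈ 𝒟, L a = v := by
  simp only [Submodule.mem_map, LinearMap.applyₗ_apply_apply]

/-- D-lines of elements of `A` lie in `A`. [cite: CurtisReiner1962, §27 (27.3)] -/
theorem map_applyₗ_le {𝒟 : Submodule ℚ (V →ₗ[ℚ] V)} {A : Submodule ℚ V}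
    (h𝒟 : ∀ L : V →ₗ[ℚ] V, L ∈ 𝒟 ↔ (∀ a ∈ A, L a ∈ A) ∧ ∀ (i : ι) (a : V), a ∈ A → L (T i a) = T i (L a))
    {a : V} (ha : a ∈ A) : 𝒟.map (LinearMap.applyₗ a) ≤ A := by
  rintro _ ⟨L, hL, rfl⟩
  exact ((h𝒟 L).1 hL).1 a ha

/-- `a ∈ D·a` (`id ∈ 𝒟`). [folklore] -/
theorem self_mem_map_applyₗ {𝒟 : Submodule ℚ (V →ₗ[ℚ] V)} {A : Submodule ℚ V}
    (h𝒟 : ∀ L : V →ₗ[ℚ] V, L ∈ 𝒟 ↔ (∀ a ∈ A, L a ∈ A) ∧ ∀ (i : ι) (a : V), a ∈ A → L (T i a) = T i (L a))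
    (a : V) : a ∈ 𝒟.map (LinearMap.applyₗ a) :=
  ⟨LinearMap.id, commutant_id_mem T h𝒟, rfl⟩

/-- A D-line of a non-zero element is non-zero. [folklore] -/
theorem map_applyₗ_ne_bot {𝒟 : Submodule ℚ (V →ₗ[ℚ] V)} {A : Submodule ℚ V}
    (h𝒟 : ∀ L : V →ₗ[ℚ] V, L ∈ 𝒟 ↔ (∀ a ∈ A, L a ∈ A) ∧ ∀ (i : ι) (a : V), a ∈ A → L (T i a) = T i (L a))
    {a : V} (ha0 : a ≠ 0) : 𝒟.map (LinearMap.applyₗ a) ≠ ⊥ := fun h =>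
  ha0 ((Submodule.mem_bot ℚ).1 (h ▸ self_mem_map_applyₗ T h𝒟 a))

/-- D-lines are stable under the commutant (composition). [cite: CurtisReiner1962, §27 (27.3)] -/
theorem map_applyₗ_stable {𝒟 : Submodule ℚ (V →ₗ[ℚ] V)} {A : Submodule ℚ V}
    (h𝒟 : ∀ L : V →ₗ[ℚ] V, L ∈ 𝒟 ↔ (∀ a ∈ A, L a ∈ A) ∧ ∀ (i : ι) (a : V), a ∈ A → L (T i a) = T i (L a))
    (a : V) : ∀ (L : ↥𝒟) (v : V), v ∈ 𝒟.map (LinearMap.applyₗ a) →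
      (L : V →ₗ[ℚ] V) v ∈ 𝒟.map (LinearMap.applyₗ a) := by
  rintro L _ ⟨L₁, hL₁, rfl⟩
  exact ⟨(L : V →ₗ[ℚ] V) ∘ₗ L₁, commutant_comp_mem T h𝒟 L.2 hL₁, rfl⟩

/-- The commutant preserves `A` (as a family indexed by `𝒟`). [cite: CurtisReiner1962, §27 (27.3)] -/
theorem commutant_stable {𝒟 : Submodule ℚ (V →ₗ[ℚ] V)} {A : Submodule ℚ V}
    (h𝒟 : ∀ L : V →ₗ[ℚ] V, L ∈ 𝒟 ↔ (∀ a ∈ A, L a ∈ A) ∧ ∀ (i : ι) (a : V), a ∈ A → L (T i a) = T i (L a)) :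
    ∀ (L : ↥𝒟) (v : V), v ∈ A → (L : V →ₗ[ℚ] V) v ∈ A :=
  fun L v hv => ((h𝒟 (L : V →ₗ[ℚ] V)).1 L.2).1 v hv

/-- **D-LINES ARE IRREDUCIBLE FOR THE COMMUTANT**: a non-zero `𝒟`-stable `W ≤ D·a` (`a ∈ A`) is `D·a` — a non-zero
`L₁ a ∈ W` gives `a = L₁⁻¹ (L₁ a) ∈ W`. [cite: CurtisReiner1962, §27 (27.3)] [cite: Lang2002, XVII §1 Prop. 1.1] -/
theorem map_applyₗ_irreducible {𝒟 : Submodule ℚ (V →ₗ[ℚ] V)} {A : Submodule ℚ V} [FiniteDimensional ℚ A]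
    (h𝒟 : ∀ L : V →ₗ[ℚ] V, L ∈ 𝒟 ↔ (∀ a ∈ A, L a ∈ A) ∧ ∀ (i : ι) (a : V), a ∈ A → L (T i a) = T i (L a))
    (hAst : ∀ (i : ι) (v : V), v ∈ A → T i v ∈ A)
    (hAirr : ∀ W : Submodule ℚ V, W ≤ A → W ≠ ⊥ → (∀ (i : ι) (v : V), v ∈ W → T i v ∈ W) → W = A)
    {a : V} (ha : a ∈ A) :
    ∀ W : Submodule ℚ V, W ≤ 𝒟.map (LinearMap.applyₗ a) → W ≠ ⊥ →
      (∀ (L : ↥𝒟) (v : V), v ∈ W → (L : V →ₗ[ℚ] V) v ∈ W) → W = 𝒟.map (LinearMap.applyₗ a) := by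
  intro W hW hW0 hWst
  refine le_antisymm hW ?_
  obtain ⟨w, hw, hw0⟩ := Submodule.exists_mem_ne_zero_of_ne_bot hW0
  obtain ⟨L₁, hL₁, rfl⟩ := (mem_map_applyₗ_iff 𝒟 a _).1 (hW hw)
  have hne : ¬ ∀ x ∈ A, L₁ x = 0 := fun h => hw0 (h a ha)
  obtain ⟨L₁', hL₁', -, hlinv, -⟩ := exists_commutant_inverse T h𝒟 hAst hAirr hL₁ hne
  have haW : a ∈ W := by
    have h := hWst ⟨L₁', hL₁'⟩ _ hw
    rwa [show ((⟨L₁', hL₁'⟩ : ↥𝒟) : V →ₗ[ℚ] V) (L₁ a) = a from hlinv a ha] at h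
  rintro _ ⟨L, hL, rfl⟩
  exact hWst ⟨L, hL⟩ a haW

/-- **TWO D-LINES ARE EQUAL OR MEET TRIVIALLY** (`a, a′ ∈ A`). [cite: CurtisReiner1962, §27 (27.3)]
[cite: Lang2002, XVII §1 Prop. 1.1] -/
theorem map_applyₗ_eq_or_inf_eq_bot {𝒟 : Submodule ℚ (V →ₗ[ℚ] V)} {A : Submodule ℚ V} [FiniteDimensional ℚ A]
    (h𝒟 : ∀ L : V →ₗ[ℚ] V, L ∈ 𝒟 ↔ (∀ a ∈ A, L a ∈ A) ∧ ∀ (i : ι) (a : V), a ∈ A → L (T i a) = T i (L a))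
    (hAst : ∀ (i : ι) (v : V), v ∈ A → T i v ∈ A)
    (hAirr : ∀ W : Submodule ℚ V, W ≤ A → W ≠ ⊥ → (∀ (i : ι) (v : V), v ∈ W → T i v ∈ W) → W = A)
    {a a' : V} (ha : a ∈ A) (ha' : a' ∈ A) :
    𝒟.map (LinearMap.applyₗ a) = 𝒟.map (LinearMap.applyₗ a') ∨
      𝒟.map (LinearMap.applyₗ a) ⊓ 𝒟.map (LinearMap.applyₗ a') = ⊥ := by
  by_cases hX : 𝒟.map (LinearMap.applyₗ a) ⊓ 𝒟.map (LinearMap.applyₗ a') = ⊥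
  · exact Or.inr hX
  left
  have hst := map_applyₗ_stable T h𝒟 (A := A)
  have hXeq : 𝒟.map (LinearMap.applyₗ a) ⊓ 𝒟.map (LinearMap.applyₗ a') = 𝒟.map (LinearMap.applyₗ a) :=
    map_applyₗ_irreducible T h𝒟 hAst hAirr ha _ inf_le_left hX
      (stable_inf (fun L : ↥𝒟 => (L : V →ₗ[ℚ] V)) (hst a) (hst a'))
  have hne : 𝒟.map (LinearMap.applyₗ a) ≠ ⊥ := fun h => hX (by rw [h, bot_inf_eq])
  exact map_applyₗ_irreducible T h𝒟 hAst hAirr ha' _ (inf_eq_left.1 hXeq) hne (hst a)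

/-- **`D·(φ a) = φ(D·a)`** for `φ ∈ span(T)` and `a ∈ A` (the span of the operators commutes with `𝒟` on `A`).
[cite: Lang2002, XVII §3] -/
theorem map_applyₗ_apply_eq_map {𝒟 : Submodule ℚ (V →ₗ[ℚ] V)} {A : Submodule ℚ V}
    (h𝒟 : ∀ L : V →ₗ[ℚ] V, L ∈ 𝒟 ↔ (∀ a ∈ A, L a ∈ A) ∧ ∀ (i : ι) (a : V), a ∈ A → L (T i a) = T i (L a))
    {φ : V →ₗ[ℚ] V} (hφ : φ ∈ Submodule.span ℚ (Set.range T)) {a : V} (ha : a ∈ A) :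
    𝒟.map (LinearMap.applyₗ (φ a)) = (𝒟.map (LinearMap.applyₗ a)).map φ := by
  ext v
  rw [mem_map_applyₗ_iff, Submodule.mem_map]
  constructor
  · rintro ⟨L, hL, rfl⟩
    exact ⟨L a, ⟨L, hL, rfl⟩, (commutant_apply_comm_of_mem_span_range T h𝒟 hL hφ ha).symm⟩
  · rintro ⟨_, ⟨L, hL, rfl⟩, rfl⟩
    exact ⟨L, hL, by rw [LinearMap.applyₗ_apply_apply]; exact commutant_apply_comm_of_mem_span_range T h𝒟 hL hφ ha⟩

/-- **ALL D-LINES OF NON-ZERO ELEMENTS OF `A` HAVE THE SAME DIMENSION `δ = [D : ℚ]`** (`T` closed under composition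
with identity; `A` finite-dimensional stable irreducible): `a′ = φ a` with `φ ∈ span(T)` gives `D·a′ = φ(D·a)`, so
`dim D·a′ ≤ dim D·a`, and symmetrically. [cite: CurtisReiner1962, §27 (27.3)] [cite: Lang2002, XVII §3] -/
theorem finrank_map_applyₗ_eq {𝒟 : Submodule ℚ (V →ₗ[ℚ] V)} {A : Submodule ℚ V} [FiniteDimensional ℚ A]
    (h𝒟 : ∀ L : V →ₗ[ℚ] V, L ∈ 𝒟 ↔ (∀ a ∈ A, L a ∈ A) ∧ ∀ (i : ι) (a : V), a ∈ A → L (T i a) = T i (L a))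
    (h1 : ∃ i₀ : ι, T i₀ = LinearMap.id) (hmul : ∀ i i' : ι, ∃ i'' : ι, T i'' = T i ∘ₗ T i')
    (hAst : ∀ (i : ι) (v : V), v ∈ A → T i v ∈ A)
    (hAirr : ∀ W : Submodule ℚ V, W ≤ A → W ≠ ⊥ → (∀ (i : ι) (v : V), v ∈ W → T i v ∈ W) → W = A)
    {a a' : V} (ha : a ∈ A) (ha0 : a ≠ 0) (ha' : a' ∈ A) (ha'0 : a' ≠ 0) :
    Module.finrank ℚ ↥(𝒟.map (LinearMap.applyₗ a)) = Module.finrank ℚ ↥(𝒟.map (LinearMap.applyₗ a')) := by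
  have key : ∀ {x x' : V}, x ∈ A → x ≠ 0 → x' ∈ A →
      Module.finrank ℚ ↥(𝒟.map (LinearMap.applyₗ x')) ≤ Module.finrank ℚ ↥(𝒟.map (LinearMap.applyₗ x)) := by
    intro x x' hx hx0 hx'
    obtain ⟨φ, hφ, rfl⟩ := exists_mem_span_range_apply_eq T h1 hmul hAst hAirr hx hx0 hx'
    haveI : FiniteDimensional ℚ ↥(𝒟.map (LinearMap.applyₗ x)) :=
      Submodule.finiteDimensional_of_le (map_applyₗ_le T h𝒟 hx)
    rw [map_applyₗ_apply_eq_map T h𝒟 hφ hx]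
    exact Submodule.finrank_map_le φ _
  exact le_antisymm (key ha' ha'0 ha) (key ha ha0 ha')

/-- **`δ ∣ dim A`**: `A` is the sum of the D-lines of a ℚ-basis, each `𝒟`-stable irreducible of dimension `δ`, and
`A` is `𝒟`-stable — file I1's dimension quantisation for the family `𝒟`.  (`A` is a `D`-vector space.)
[cite: CurtisReiner1962, §27 (27.3)] [cite: Lang2002, XVII §1 Prop. 1.1] -/
theorem finrank_map_applyₗ_dvd_finrank {𝒟 : Submodule ℚ (V →ₗ[ℚ] V)} {A : Submodule ℚ V} [FiniteDimensional ℚ A]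
    (h𝒟 : ∀ L : V →ₗ[ℚ] V, L ∈ 𝒟 ↔ (∀ a ∈ A, L a ∈ A) ∧ ∀ (i : ι) (a : V), a ∈ A → L (T i a) = T i (L a))
    (h1 : ∃ i₀ : ι, T i₀ = LinearMap.id) (hmul : ∀ i i' : ι, ∃ i'' : ι, T i'' = T i ∘ₗ T i')
    (hAst : ∀ (i : ι) (v : V), v ∈ A → T i v ∈ A)
    (hAirr : ∀ W : Submodule ℚ V, W ≤ A → W ≠ ⊥ → (∀ (i : ι) (v : V), v ∈ W → T i v ∈ W) → W = A)
    {a₀ : V} (ha₀ : a₀ ∈ A) (h0 : a₀ ≠ 0) :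
    Module.finrank ℚ ↥(𝒟.map (LinearMap.applyₗ a₀)) ∣ Module.finrank ℚ A := by
  let s := Module.finBasis ℚ A
  let N : Fin (Module.finrank ℚ A) → Submodule ℚ V := fun k => 𝒟.map (LinearMap.applyₗ (s k : V))
  haveI : ∀ k, FiniteDimensional ℚ (N k) := fun k =>
    Submodule.finiteDimensional_of_le (map_applyₗ_le T h𝒟 (s k).2)
  have hNst : ∀ (k : Fin (Module.finrank ℚ A)) (L : ↥𝒟) (v : V), v ∈ N k → (L : V →ₗ[ℚ] V) v ∈ N k :=
    fun k => map_applyₗ_stable T h𝒟 (s k : V)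
  have hNirr : ∀ (k : Fin (Module.finrank ℚ A)) (W : Submodule ℚ V), W ≤ N k → W ≠ ⊥ →
      (∀ (L : ↥𝒟) (v : V), v ∈ W → (L : V →ₗ[ℚ] V) v ∈ W) → W = N k :=
    fun k => map_applyₗ_irreducible T h𝒟 hAst hAirr (s k).2
  have hd : ∀ k, N k = ⊥ ∨ Module.finrank ℚ (N k) = Module.finrank ℚ ↥(𝒟.map (LinearMap.applyₗ a₀)) :=
    fun k => Or.inr (finrank_map_applyₗ_eq T h𝒟 h1 hmul hAst hAirr (s k).2
      (fun h => s.ne_zero k (Submodule.coe_eq_zero.1 h)) ha₀ h0)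
  have hle : A ≤ ⨆ k, N k := by
    intro a ha
    have h : a = ∑ k, ((s.repr ⟨a, ha⟩ k • s k : A) : V) := by
      have h := congrArg Subtype.val (s.sum_repr ⟨a, ha⟩)
      rw [Submodule.coe_sum] at h
      exact h.symm
    rw [h]
    refine Submodule.sum_mem _ fun k _ => ?_
    rw [Submodule.coe_smul]
    exact Submodule.smul_mem _ _ (Submodule.mem_iSup_of_mem k (self_mem_map_applyₗ T h𝒟 (s k : V)))
  exact dvd_finrank_of_stable_le_iSup (fun L : ↥𝒟 => (L : V →ₗ[ℚ] V)) hNst hNirr hd (commutant_stable T h𝒟) hle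

end Summit.HodgeConjecture.CorCM.IrrOdd

end
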